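import Summits.Ventures.PercRepro.RankLevelSetTightLayer

/-!
# PercRepro — THE AVERAGED CONTRACTION IDENTITY, PART 1: the middle level sets of all the `M ／ {e}` at once
(night-1, gen 9 session 4; paper proofs/NIGHT-1-C025-induction.md §19.12 (a))

Summing the single-element identity over ALL elements `e` turns the contraction side into plain set counts of `M`:
`Σ_{e ∈ E} #Y_{M ／ {e}}(p − 1, q) = Σ_{T ⊆ E, q+1 < r(T) < p} |T|` — every middle set of `M ／ {e}` is `T ∖ {e}` for a
unique `T ∋ e` with `q + 1 < r_M(T) < p`, and a set `T` is counted once for each of its elements.  No tight-layer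
hypothesis is needed here (only that every element is a non-loop).

* `Yset_contract_ncard_eq` — `#Y_{M ／ {e}}(p−1, q) = #{T ∈ Y_M(p, q+1) : e ∈ T}` (the bijection `A ↦ insert e A`);
* `sum_card_filter_mem_eq_sum_card` — the double count `Σ_e #{T ∈ S : e ∈ T} = Σ_{T ∈ S} |T|` for a finite family;
* `sum_midCount_contract_eq` — the identity above, as a sum over `M.E.toFinset`.

Axioms: standard.
-/
open scoped Matroid

namespace PercRepro

open Set Finset

variable {α : Type} (M : Matroid α) [M.Finite]

omit [M.Finite] in
/-- The middle sets of `M ／ {e}` at `(p − 1, q)` are exactly the sets `T ∖ {e}` with `T ∋ e` in `Y_M(p, q + 1)`. -/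
lemma Yset_contract_eq_image {e : α} (he : M.IsNonloop e) {p q : ℕ} (hp : 1 ≤ p) :
    (fun A : Set α => insert e A) '' Yset (M ／ {e}) (p - 1) q = {T ∈ Yset M p (q + 1) | e ∈ T} := by
  ext T
  constructor
  · rintro ⟨A, ⟨hAE, hq, hp'⟩, rfl⟩
    have hrk := eRk_insert_eq_contract_add_one M he hAE
    refine ⟨⟨?_, ?_, ?_⟩, mem_insert e A⟩
    · exact insert_subset he.mem_ground (hAE.trans (M.contract_ground_subset_ground {e}))
    · rw [hrk]
      have : ((q + 1 : ℕ) : ℕ∞) = (q : ℕ∞) + 1 := by push_cast; rfl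
      rw [this]
      exact (ENat.add_lt_add_iff_right (by simp)).2 hq
    · rw [hrk]
      have h1 : (M ／ {e}).eRk A + 1 ≤ ((p - 1 : ℕ) : ℕ∞) :=
        (ENat.add_one_le_iff' (ENat.coe_ne_top _)).2 hp'
      have h2 : ((p - 1 : ℕ) : ℕ∞) < (p : ℕ∞) := by exact_mod_cast (by omega : p - 1 < p)
      exact lt_of_le_of_lt h1 h2
  · rintro ⟨⟨hTE, hq, hp'⟩, heT⟩
    refine ⟨T \ {e}, ⟨?_, ?_, ?_⟩, ?_⟩
    · rw [Matroid.contract_ground]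
      exact sdiff_subset_sdiff_left hTE
    · have hAE : T \ {e} ⊆ (M ／ {e}).E := by
        rw [Matroid.contract_ground]; exact sdiff_subset_sdiff_left hTE
      have hrk := eRk_insert_eq_contract_add_one M he hAE
      rw [insert_sdiff_singleton, insert_eq_of_mem heT] at hrk
      rw [hrk] at hq
      have : ((q + 1 : ℕ) : ℕ∞) = (q : ℕ∞) + 1 := by push_cast; rfl
      rw [this] at hq
      exact (ENat.add_lt_add_iff_right (by simp)).1 hq
    · have hAE : T \ {e} ⊆ (M ／ {e}).E := by
        rw [Matroid.contract_ground]; exact sdiff_subset_sdiff_left hTE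
      have hrk := eRk_insert_eq_contract_add_one M he hAE
      rw [insert_sdiff_singleton, insert_eq_of_mem heT] at hrk
      rw [hrk] at hp'
      have hp1 : (p : ℕ∞) = ((p - 1 : ℕ) : ℕ∞) + 1 := by
        rw [← Nat.cast_add_one, Nat.sub_add_cancel hp]
      rw [hp1] at hp'
      exact (ENat.add_lt_add_iff_right (by simp)).1 hp'
    · exact insert_sdiff_singleton.trans (insert_eq_of_mem heT)

/-- `Y_{M ／ {e}}(p − 1, q)` is finite. -/
lemma Yset_contract_finite (e : α) (p q : ℕ) : (Yset (M ／ {e}) (p - 1) q).Finite := by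
  have : (M ／ {e}).Finite := inferInstance
  exact Yset_finite (M ／ {e}) (p - 1) q

omit [M.Finite] in
/-- `#Y_{M ／ {e}}(p − 1, q) = #{T ∈ Y_M(p, q + 1) : e ∈ T}`. -/
lemma Yset_contract_ncard_eq {e : α} (he : M.IsNonloop e) {p q : ℕ} (hp : 1 ≤ p) :
    (Yset (M ／ {e}) (p - 1) q).ncard = {T ∈ Yset M p (q + 1) | e ∈ T}.ncard := by
  rw [← Yset_contract_eq_image M he hp]
  refine (Set.InjOn.ncard_image ?_).symm
  rintro A ⟨hAE, -, -⟩ A' ⟨hA'E, -, -⟩ hEq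
  have heA : e ∉ A := fun h => (hAE h).2 rfl
  have heA' : e ∉ A' := fun h => (hA'E h).2 rfl
  have h1 : insert e A \ {e} = insert e A' \ {e} := by
    simp only at hEq
    rw [hEq]
  rwa [insert_sdiff_self_of_notMem heA, insert_sdiff_self_of_notMem heA'] at h1

open scoped Classical in
/-- The double count: for a finite family `S` of subsets of a finite set `E`,
`Σ_{e ∈ E} #{T ∈ S : e ∈ T} = Σ_{T ∈ S} |T|`. -/
lemma sum_card_filter_mem_eq_sum_ncard {β : Type} (E : Finset β) (S : Finset (Set β))
    (hS : ∀ T ∈ S, T ⊆ (E : Set β)) :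
    ∑ e ∈ E, (S.filter (fun T => e ∈ T)).card = ∑ T ∈ S, T.ncard := by
  calc ∑ e ∈ E, (S.filter (fun T => e ∈ T)).card
      = ∑ e ∈ E, ∑ T ∈ S, (if e ∈ T then 1 else 0) := by
        refine Finset.sum_congr rfl (fun e _ => ?_)
        rw [Finset.card_filter]
    _ = ∑ T ∈ S, ∑ e ∈ E, (if e ∈ T then 1 else 0) := Finset.sum_comm
    _ = ∑ T ∈ S, T.ncard := by
        refine Finset.sum_congr rfl (fun T hT => ?_)
        rw [← Finset.card_filter]
        have hT' : T = ((E.filter (fun x => x ∈ T) : Finset β) : Set β) := by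
          ext x
          simp only [Finset.coe_filter, Set.mem_setOf_eq]
          exact ⟨fun hx => ⟨hS T hT hx, hx⟩, fun hx => hx.2⟩
        conv_rhs => rw [hT']
        rw [Set.ncard_coe_finset]

open scoped Classical in
/-- For `e ∈ E` the middle count of `M ／ {e}` is the number of middle sets of `M` at `(p, q + 1)` containing `e`. -/
lemma midCount_contract_eq_card_filter {e : α} (he : M.IsNonloop e) {p q : ℕ} (hp : 1 ≤ p) :
    Matroid.midCount (M ／ {e}) (p - 1) q =
      ((Yset_finite M p (q + 1)).toFinset.filter (fun T => e ∈ T)).card := by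
  classical
  have : (M ／ {e}).Finite := inferInstance
  rw [midCount_eq_ncard_Yset, Yset_contract_ncard_eq M he hp]
  have hset : {T ∈ Yset M p (q + 1) | e ∈ T} =
      (((Yset_finite M p (q + 1)).toFinset.filter (fun T => e ∈ T) : Finset (Set α)) : Set (Set α)) := by
    ext T
    simp only [Set.mem_setOf_eq, Finset.coe_filter, Set.Finite.mem_toFinset]
  rw [hset, Set.ncard_coe_finset]

open scoped Classical in
/-- **THE MIDDLE HALF OF THE AVERAGED IDENTITY**: if every element of `M` is a non-loop and `1 ≤ p`, then
`Σ_{e ∈ E} #Y_{M ／ {e}}(p − 1, q) = Σ_{T ∈ Y_M(p, q + 1)} |T|`. -/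
theorem sum_midCount_contract_eq (hl : ∀ e ∈ M.E, M.IsNonloop e) {p q : ℕ} (hp : 1 ≤ p) :
    ∑ e ∈ (M.set_finite M.E).toFinset, Matroid.midCount (M ／ {e}) (p - 1) q =
      ∑ T ∈ (Yset_finite M p (q + 1)).toFinset, T.ncard := by
  classical
  rw [← sum_card_filter_mem_eq_sum_ncard (M.set_finite M.E).toFinset (Yset_finite M p (q + 1)).toFinset
    (fun T hT => by
      rw [Set.Finite.mem_toFinset] at hT
      rw [Set.Finite.coe_toFinset]
      exact hT.1)]
  refine Finset.sum_congr rfl (fun e he => ?_)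
  rw [Set.Finite.mem_toFinset] at he
  exact midCount_contract_eq_card_filter M (hl e he) hp

end PercRepro
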